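import Summits.AtomisticToContinuum.Crystallization.Theses.PhononSlackCertificates
import Summits.AtomisticToContinuum.Crystallization.Theorems.ReggeStarCoercivityDefectFreeCrystallizesLayeredGluing01
import Summits.AtomisticToContinuum.Crystallization.Theorems.ReggeStarCoercivityDefectFreeCrystallizesLayeredGluingDefs

/-!
# Disproof of `HullBridge` (crux stmt-AtomisticToContinuum-15147, route `PhononSlackCertificates`) — findings

Standing disprover `refuter-cdisprove-stmt-AtomisticToContinuum-15147-0`, cycle 1 (2026-08-16).
Everything below is checked (rc 0, no `sorry`); prose only in docstrings.

VERDICT OF CYCLE 1: **no kill; the crux resists for a structural reason** (§4): `HullBridge` is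
`CoerciveTwoShellGap → NearFieldConvexity → LayeredWindows` (`hullBridge_iff`, `Iff.rfl`), so
`¬ HullBridge ↔ CoerciveTwoShellGap ∧ NearFieldConvexity ∧ ¬ LayeredWindows` (`not_hullBridge_iff`): an
unconditional refutation must PROVE the two XL antecedent cruxes (13956, 13958) and REFUTE the positional
crystallization content.  No formalisation defect was found that makes the conclusion cheaply false: the box
`a ∈ [47/50, 1]`, `h ∈ [39a/50, 17a/20]` contains the Lennard-Jones values (`a* = (A₁₂/A₆)^{1/6} ≈ 0.9712`
for `V = r⁻¹²/12 − r⁻⁶/6`, ideal `h/a = √(2/3) ≈ 0.8165`), the unreduced `haggLabel` is harmless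
(`3w = u + v`, `triangularVec_add`), and the two-shell patterns are the correct 18-point fcc/hcp sets.
Cheap-vacuity attacks on the antecedents (which would make the crux trivially TRUE and kill 13956/13958
instead) also fail: `N = 1` only forces `g ≤ |e*|`; dense `δ`-clouds outside a good region depress
`Σ_Ω e_i` by a SURFACE term `~ρ(δ)L²`, absorbed by `C(δ,η)·#∂₄Ω`; strains below `η` are layered (free),
strains in `(η, 1/20)` cost `≳ K η²`; the box edges are `O(%)` away from `a*`, `h*`.

FINDINGS (index):
* §0 `hullBridge_iff`, §2 `hullBridge_iff_matrix` — normal forms (`WindowAt`, `LayeredWindowsMatrix`).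
* §1 `exists_two_template_points` — every box template, in any frame, shows a point of norm `< 2` and a
  second one of norm `< 3` at distance exactly `a` (uses `exists_height_small`: some layer height in
  `[0, 17/20]`; planar reduction `L = 3k + r`).
* §3 LOAD-BEARING (`IsGroundState`): `not_windowAt_of_sparse` (a `10`-separated configuration has no
  `(3, 1/4)`-window), `not_windowAt_of_subsingleton` (small model `N ≤ 1`), `not_matrix_forall`
  ("frequently in `N`" cannot become "for all `N`", for ANY sequence), `not_matrix_gasSeq`,
  `layeredWindows_false_without_groundState` (the conclusion with `IsGroundState` replaced by injectivity is
  FALSE — witness the gas `gasSeq`), `hullBridgeWithoutGroundState_iff` (the so-weakened crux holds iff an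
  antecedent crux is false).
* §4 `not_hullBridge_iff`, `hullBridge_of_layeredWindows`, `hullBridge_of_not_coerciveTwoShellGap`,
  `hullBridge_of_not_nearFieldConvexity` — logical position.
* §5 LINE `Sketch`: the only open atom is the tree Prop `PrestressSplitKorn.ExactLayeredRigidity`
  (`HullBridge ⟸ LayeredGluing ⟸ ExactLayeredRigidity`, all other stubs landed).  Attack by pure geometry
  found NO counterexample; `registry_lemma` is the arithmetic core of why a silent switch of the stacking
  normal needs an IDEALLY spaced, constant-letter (fcc) buffer, and complete-plane propagation then forces a
  junction.  `exactNear_template`: the atom's hypothesis is satisfied by every template (non-vacuous).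
* Targets / stuck stubs: none handed over this cycle (`payload.stuck_stubs = []`).

NEAR-MISSES: none with a `sorry`.  Next regimes if re-armed: (i) the windowed (finite `R'`) form of the
rigidity atom at the sparsest box corner `a = 1`, `h = 17/20` (lens point counts), (ii) `η`-vs-`R`
dependence in `LayeredGluing` (slow bending: `η` must be `O(ε a²/R²)`), (iii) if the lead reshapes the
line to the ideator-1 junction route, the margin `√3·R` of `junction_bound` is TIGHT (planes
`⟪n₁,n₂⟫ = 1/3`, `d₁ = −d₂ = R`).
-/

noncomputable section

open scoped BigOperators Classical
open Filter Topology

namespace Summit.AtomisticToContinuum.Crystallization.Cruxes.HullBridge.Disproof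

open Summit.AtomisticToContinuum.Crystallization.Theses.PhononSlackCertificates
open Summit.AtomisticToContinuum.Crystallization.Theorems.PrestressSplitKorn
open Literature.MathematicalPhysics.StatisticalMechanics Literature.Geometry.DiscreteGeometry

local notation "E3" => EuclideanSpace ℝ (Fin 3)

/-! ## §0 Normal form of the crux -/

/-- `HullBridge` is, definitionally, `CoerciveTwoShellGap → NearFieldConvexity → LayeredWindows`. -/
theorem hullBridge_iff :
    HullBridge ↔ (CoerciveTwoShellGap → NearFieldConvexity → LayeredWindows) := Iff.rfl

/-! ## §1 Box templates always show two close points near the origin -/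

/-- `‖x‖² = x₀² + x₁² + x₂²` in `ℝ³`. [folklore] -/
theorem dp_norm_sq_fin3 (x : E3) : ‖x‖ ^ 2 = x 0 ^ 2 + x 1 ^ 2 + x 2 ^ 2 := by
  rw [EuclideanSpace.norm_sq_eq, Fin.sum_univ_three, Real.norm_eq_abs, Real.norm_eq_abs,
    Real.norm_eq_abs, sq_abs, sq_abs, sq_abs]

/-- `‖x‖² < 4 → ‖x‖ < 2`. [folklore] -/
theorem dp_norm_lt_two_of_sq {x : E3} (h : ‖x‖ ^ 2 < 4) : ‖x‖ < 2 := by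
  nlinarith [norm_nonneg x]

/-- A box height function takes a value in `[0, 17/20]`. -/
theorem exists_height_small {a : ℝ} {z : ℤ → ℝ} (h : InBox a z) :
    ∃ m : ℤ, 0 ≤ z m ∧ z m ≤ 17 / 20 := by
  have ha : 47 / 50 ≤ a := h.1
  have ha1 : a ≤ 1 := h.2.1
  have hc : 0 < 39 / 50 * a := by linarith
  have hmono : StrictMono z := strictMono_int_of_lt_succ fun m => by linarith [(h.2.2 m).1]
  -- a nonnegative value far up
  obtain ⟨n₂, hn₂⟩ := exists_nat_gt (-z 0 / (39 / 50 * a))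
  have hpos : 0 ≤ z (n₂ : ℤ) := by
    have h1 := (h.le_z_natCast n₂).1
    have : -z 0 < 39 / 50 * a * n₂ := by
      rw [div_lt_iff₀ hc] at hn₂; linarith
    linarith
  -- a negative value far down
  obtain ⟨n₁, hn₁⟩ := exists_nat_gt (z 0 / (39 / 50 * a))
  have hneg : z (-(n₁ : ℤ)) < 0 := by
    have h1 := (h.le_z_neg_natCast n₁).1
    have : z 0 < 39 / 50 * a * n₁ := by
      rw [div_lt_iff₀ hc] at hn₁; linarith
    linarith
  -- least nonnegative layer
  obtain ⟨m₀, hm₀, hmin⟩ := Int.exists_least_of_bdd (P := fun m => 0 ≤ z m)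
    ⟨-(n₁ : ℤ), fun m hm => by
      by_contra hlt
      push Not at hlt
      have := hmono hlt
      linarith⟩ ⟨(n₂ : ℤ), hpos⟩
  have hprev : z (m₀ - 1) < 0 := by
    by_contra hge
    push Not at hge
    have := hmin _ hge
    omega
  have hstep := (h.2.2 (m₀ - 1)).2
  rw [sub_add_cancel] at hstep
  exact ⟨m₀, hm₀, by nlinarith⟩

/-- `u + v = 3 w` for the layer generators and the hole offset. -/
theorem triangularVec_add (a : ℝ) :
    triangularVec₁ a + triangularVec₂ a = (3 : ℝ) • barlowOffset a := by
  ext i; fin_cases i <;> simp [triangularVec₁, triangularVec₂, barlowOffset] <;> ring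

/-- `‖u‖ = a`. -/
theorem norm_triangularVec₁ {a : ℝ} (ha : 0 ≤ a) : ‖triangularVec₁ a‖ = a := by
  have h' : ‖triangularVec₁ a‖ ^ 2 = a ^ 2 := by
    rw [dp_norm_sq_fin3]; simp [triangularVec₁]
  nlinarith [norm_nonneg (triangularVec₁ a), sq_nonneg (‖triangularVec₁ a‖ - a),
    sq_nonneg (‖triangularVec₁ a‖ + a)]

/-- **Two close template points near the origin.** Every box template `l ↦ A (layeredPos a s z l)`
(any linear isometry `A`, any word `s`, no translation) has a point of norm `< 2` and a second point of
norm `< 3` at distance exactly `a` from it. -/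
theorem exists_two_template_points {a : ℝ} {z : ℤ → ℝ} (h : InBox a z) (s : ℤ → ℤ)
    (A : E3 →ₗᵢ[ℝ] E3) :
    ∃ l l' : ℤ × ℤ × ℤ, ‖A (layeredPos a s z l)‖ < 2 ∧ ‖A (layeredPos a s z l')‖ < 3 ∧
      dist (A (layeredPos a s z l)) (A (layeredPos a s z l')) = a := by
  have ha : 47 / 50 ≤ a := h.1
  have ha1 : a ≤ 1 := h.2.1
  obtain ⟨m, hm0, hm1⟩ := exists_height_small h
  set L : ℤ := haggLabel s m with hL
  set k : ℤ := L / 3 with hk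
  set r : ℤ := L % 3 with hr
  have hLkr : L = 3 * k + r := by rw [hk, hr]; omega
  have hr0 : 0 ≤ r := Int.emod_nonneg _ (by norm_num)
  have hr3 : r < 3 := Int.emod_lt_of_pos _ (by norm_num)
  have hr2 : (r : ℝ) ≤ 2 := by exact_mod_cast (by omega : r ≤ 2)
  have hr0' : (0 : ℝ) ≤ r := by exact_mod_cast hr0
  -- the planar reduction: layer `m`, indices `(-k, -k)` gives `r • w + z m • e₃`
  have hq : layeredPos a s z (m, -k, -k) = (r : ℝ) • barlowOffset a + z m • layerNormal 1 := by
    have hLr : (haggLabel s m : ℝ) = 3 * (k : ℝ) + (r : ℝ) := by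
      rw [← hL, hLkr]; push_cast; ring
    simp only [layeredPos, hLr]
    have huv := triangularVec_add a
    push_cast
    rw [show (3 * (k : ℝ) + r) • barlowOffset a = (k : ℝ) • ((3 : ℝ) • barlowOffset a) + (r : ℝ) • barlowOffset a
      by module, ← huv]
    module
  have hq' : layeredPos a s z (m, -k + 1, -k) =
      ((r : ℝ) • barlowOffset a + z m • layerNormal 1) + triangularVec₁ a := by
    have : layeredPos a s z (m, -k + 1, -k) = layeredPos a s z (m, -k, -k) + triangularVec₁ a := by
      simp only [layeredPos]; push_cast; module
    rw [this, hq]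
  -- norms
  have h3 : (√3 : ℝ) ^ 2 = 3 := Real.sq_sqrt (by norm_num)
  have hnq : ‖(r : ℝ) • barlowOffset a + z m • layerNormal 1‖ < 2 := by
    apply dp_norm_lt_two_of_sq
    rw [dp_norm_sq_fin3]
    simp [barlowOffset, layerNormal]
    have hr2sq : (r : ℝ) ^ 2 ≤ 4 := by nlinarith
    have ha2 : a ^ 2 ≤ 1 := by nlinarith
    have hz2 : z m ^ 2 ≤ (17 / 20) ^ 2 := by nlinarith
    nlinarith [h3, mul_nonneg (sq_nonneg (r : ℝ)) (sq_nonneg a)]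
  refine ⟨(m, -k, -k), (m, -k + 1, -k), ?_, ?_, ?_⟩
  · rw [LinearIsometry.norm_map, hq]; exact hnq
  · rw [LinearIsometry.norm_map, hq']
    calc ‖(r : ℝ) • barlowOffset a + z m • layerNormal 1 + triangularVec₁ a‖
        ≤ ‖(r : ℝ) • barlowOffset a + z m • layerNormal 1‖ + ‖triangularVec₁ a‖ := norm_add_le _ _
      _ < 2 + 1 := by
          rw [norm_triangularVec₁ (by linarith)]
          linarith
      _ = 3 := by norm_num
  · rw [LinearIsometry.dist_map, hq, hq', dist_eq_norm, sub_add_cancel_left, norm_neg,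
      norm_triangularVec₁ (by linarith)]

/-! ## §2 The window predicate of the conclusion and its matrix -/

/-- The `(R, ε)`-window clause of `LayeredWindows` / `HullBridge` for ONE finite configuration `y` at
in-layer spacing `a` (verbatim text of the Theses decl: rigid motion `(A, t)`, Hägg word `s`, box heights `z`). -/
def WindowAt {N : ℕ} (a R ε : ℝ) (y : Fin N → E3) : Prop :=
  ∃ (A : EuclideanSpace ℝ (Fin 3) →ₗᵢ[ℝ] EuclideanSpace ℝ (Fin 3)) (t : EuclideanSpace ℝ (Fin 3)) (s : ℤ → ℤ) (z : ℤ → ℝ), Literature.MathematicalPhysics.StatisticalMechanics.IsHaggSeq s ∧ (∀ m : ℤ, 39 / 50 * a ≤ z (m + 1) - z m ∧ z (m + 1) - z m ≤ 17 / 20 * a) ∧ let S : Set (EuclideanSpace ℝ (Fin 3)) := {p | ∃ m i j : ℤ, p = A (((i : ℝ) • Literature.MathematicalPhysics.StatisticalMechanics.triangularVec₁ a) + ((j : ℝ) • Literature.MathematicalPhysics.StatisticalMechanics.triangularVec₂ a) + ((Literature.MathematicalPhysics.StatisticalMechanics.haggLabel s m : ℝ) • Literature.MathematicalPhysics.StatisticalMechanics.barlowOffset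 a) + (z m • Literature.MathematicalPhysics.StatisticalMechanics.layerNormal 1))}; (∀ p ∈ S, ‖p‖ ≤ R → ∃ i : Fin N, dist (y i + t) p ≤ ε) ∧ (∀ i : Fin N, ‖y i + t‖ ≤ R → ∃ p ∈ S, dist (y i + t) p ≤ ε)

/-- The conclusion ("matrix") of `HullBridge` / `LayeredWindows` for ONE sequence `x`: one in-layer
spacing `a ∈ [47/50, 1]` serving windows of every scale frequently in `N`. -/
def LayeredWindowsMatrix (x : (N : ℕ) → (Fin N → E3)) : Prop :=
  ∃ a : ℝ, 47 / 50 ≤ a ∧ a ≤ 1 ∧ ∀ R ε : ℝ, 0 < ε → ∃ᶠ N in Filter.atTop, WindowAt a R ε (x N)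

/-- `LayeredWindows` is "every ground-state sequence satisfies the matrix" (definitional). -/
theorem layeredWindows_iff_matrix :
    LayeredWindows ↔ ∀ x : (N : ℕ) → (Fin N → E3),
      (∀ N, IsGroundState lennardJones (x N)) → LayeredWindowsMatrix x := Iff.rfl

/-- Hence the crux reads `CoerciveTwoShellGap → NearFieldConvexity → ∀ x, ground states → matrix`. -/
theorem hullBridge_iff_matrix :
    HullBridge ↔ (CoerciveTwoShellGap → NearFieldConvexity → ∀ x : (N : ℕ) → (Fin N → E3),
      (∀ N, IsGroundState lennardJones (x N)) → LayeredWindowsMatrix x) := Iff.rfl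

/-! ## §3 LOAD-BEARING: sparse configurations (in particular `N ≤ 1`) have no window

Any proof of the crux must use `IsGroundState` beyond distinctness of the particles: the matrix fails for
every sequence of `10`-separated configurations (a "gas"), at the single scale `(R, ε) = (3, 1/4)`. -/

/-- **No window in a gas.** If the particles of `y` are pairwise `≥ 10` apart (vacuous for `N ≤ 1`), then
`y` has no `(3, 1/4)`-window at any box spacing `a ∈ [47/50, 1]`: the template shows two points `p, p'` in
the `3`-ball at distance `a ∈ [47/50, 1]`, which would have to be `1/4`-close to particles — the same
particle (then `a ≤ 1/2`) or two particles `≤ 3/2` apart. -/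
theorem not_windowAt_of_sparse {N : ℕ} {y : Fin N → E3} (hy : ∀ i j : Fin N, i ≠ j → 10 ≤ dist (y i) (y j))
    {a : ℝ} (ha : 47 / 50 ≤ a) (ha1 : a ≤ 1) : ¬ WindowAt a 3 (1 / 4) y := by
  rintro ⟨A, t, s, z, -, hz, hW, -⟩
  have hbox : InBox a z := ⟨ha, ha1, hz⟩
  obtain ⟨l, l', hl, hl', hd⟩ := exists_two_template_points hbox s A
  have hmem : ∀ l₀ : ℤ × ℤ × ℤ, A (layeredPos a s z l₀) ∈ {p : E3 | ∃ m i j : ℤ, p = A (((i : ℝ) • triangularVec₁ a) +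
      ((j : ℝ) • triangularVec₂ a) + ((haggLabel s m : ℝ) • barlowOffset a) + (z m • layerNormal 1))} :=
    fun l₀ => ⟨l₀.1, l₀.2.1, l₀.2.2, rfl⟩
  obtain ⟨i, hi⟩ := hW _ (hmem l) (by linarith)
  obtain ⟨i', hi'⟩ := hW _ (hmem l') hl'.le
  by_cases hii : i = i'
  · subst hii
    have : dist (A (layeredPos a s z l)) (A (layeredPos a s z l')) ≤ 1 / 4 + 1 / 4 := by
      calc dist (A (layeredPos a s z l)) (A (layeredPos a s z l'))
          ≤ dist (A (layeredPos a s z l)) (y i + t) + dist (y i + t) (A (layeredPos a s z l')) := dist_triangle _ _ _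
        _ ≤ 1 / 4 + 1 / 4 := by rw [dist_comm] at hi; exact add_le_add hi hi'
    linarith
  · have h10 := hy i i' hii
    have : dist (y i) (y i') ≤ 1 / 4 + a + 1 / 4 := by
      have e1 : dist (y i) (y i') = dist (y i + t) (y i' + t) := by simp [dist_eq_norm]
      rw [e1]
      calc dist (y i + t) (y i' + t)
          ≤ dist (y i + t) (A (layeredPos a s z l)) + dist (A (layeredPos a s z l)) (y i' + t) := dist_triangle _ _ _
        _ ≤ dist (y i + t) (A (layeredPos a s z l)) +
            (dist (A (layeredPos a s z l)) (A (layeredPos a s z l')) + dist (A (layeredPos a s z l')) (y i' + t)) :=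
            by gcongr; exact dist_triangle _ _ _
        _ ≤ 1 / 4 + (a + 1 / 4) := by rw [hd, dist_comm (A _) (y i' + t)]; gcongr
        _ = 1 / 4 + a + 1 / 4 := by ring
    linarith

/-- **Small model `N ≤ 1`**: the empty and the one-particle configuration have no `(3, 1/4)`-window.  So the
window clause is false for `N = 0, 1` whatever the sequence: "frequently in `N`" in the crux cannot be
strengthened to "for all `N`", and a prover must produce windows at LARGE `N`. -/
theorem not_windowAt_of_subsingleton {N : ℕ} (hN : N ≤ 1) (y : Fin N → E3) {a : ℝ} (ha : 47 / 50 ≤ a)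
    (ha1 : a ≤ 1) : ¬ WindowAt a 3 (1 / 4) y :=
  not_windowAt_of_sparse (fun i j hij => absurd (Fin.ext (by omega)) hij) ha ha1

/-- The natural strengthening "windows for ALL `N`" of the matrix is false for EVERY sequence. -/
theorem not_matrix_forall (x : (N : ℕ) → (Fin N → E3)) :
    ¬ ∃ a : ℝ, 47 / 50 ≤ a ∧ a ≤ 1 ∧ ∀ R ε : ℝ, 0 < ε → ∀ N, WindowAt a R ε (x N) := by
  rintro ⟨a, ha, ha1, h⟩
  exact not_windowAt_of_subsingleton (le_refl 1) (x 1) ha ha1 (h 3 (1 / 4) (by norm_num) 1)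

/-- The gas sequence: particle `i` at height `10 i` on the vertical axis. -/
def gasSeq (N : ℕ) (i : Fin N) : E3 := ((10 * (i : ℕ) : ℕ) : ℝ) • layerNormal 1

/-- `‖e₃‖ = 1`. -/
theorem norm_layerNormal_one : ‖(layerNormal 1 : E3)‖ = 1 := by
  have h : ‖(layerNormal 1 : E3)‖ ^ 2 = 1 := by rw [dp_norm_sq_fin3]; simp [layerNormal]
  nlinarith [norm_nonneg (layerNormal 1 : E3)]

/-- The gas is `10`-separated. -/
theorem gasSeq_sparse (N : ℕ) : ∀ i j : Fin N, i ≠ j → 10 ≤ dist (gasSeq N i) (gasSeq N j) := by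
  intro i j hij
  have hne : (i : ℕ) ≠ j := fun h => hij (Fin.ext h)
  rw [gasSeq, gasSeq, dist_eq_norm, ← sub_smul, norm_smul, norm_layerNormal_one, mul_one, Real.norm_eq_abs]
  push_cast
  rcases Nat.lt_or_gt_of_ne hne with hlt | hlt
  · have h1 : (i : ℝ) + 1 ≤ j := by exact_mod_cast hlt
    rw [abs_of_nonpos (by linarith)]; linarith
  · have h1 : (j : ℝ) + 1 ≤ i := by exact_mod_cast hlt
    rw [abs_of_nonneg (by linarith)]; linarith

/-- The gas consists of distinct particles. -/
theorem gasSeq_injective (N : ℕ) : Function.Injective (gasSeq N) := by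
  intro i j h
  by_contra hij
  have := gasSeq_sparse N i j hij
  rw [h, dist_self] at this
  linarith

/-- **The matrix fails for the gas.** -/
theorem not_matrix_gasSeq : ¬ LayeredWindowsMatrix gasSeq := by
  rintro ⟨a, ha, ha1, h⟩
  obtain ⟨N, hN⟩ := (h 3 (1 / 4) (by norm_num)).exists
  exact not_windowAt_of_sparse (gasSeq_sparse N) ha ha1 hN

/-- `LayeredWindows` with `IsGroundState lennardJones (x N)` REPLACED by `Function.Injective (x N)`
(everything else verbatim). -/
def LayeredWindowsWithoutGroundState : Prop :=
  ∀ x : (N : ℕ) → (Fin N → E3), (∀ N, Function.Injective (x N)) → LayeredWindowsMatrix x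

/-- **Load-bearing hypothesis.** Without exact minimality the conclusion of the crux is false
(witness: the gas).  So `HullBridge` cannot be proved by an argument blind to `IsGroundState`, unless that
argument REFUTES one of the two antecedent cruxes (see `hullBridgeWithoutGroundState_iff`). -/
theorem layeredWindows_false_without_groundState : ¬ LayeredWindowsWithoutGroundState :=
  fun h => not_matrix_gasSeq (h gasSeq gasSeq_injective)

/-- `HullBridge` with the ground-state hypothesis of its conclusion weakened to injectivity. -/
def HullBridgeWithoutGroundState : Prop :=
  CoerciveTwoShellGap → NearFieldConvexity → LayeredWindowsWithoutGroundState

/-- … which holds IFF one of the two antecedent cruxes (13956 `CoerciveTwoShellGap`, 13958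
`NearFieldConvexity`) is false: the weakened crux is exactly as hard as refuting the route's engine. -/
theorem hullBridgeWithoutGroundState_iff :
    HullBridgeWithoutGroundState ↔ ¬ (CoerciveTwoShellGap ∧ NearFieldConvexity) := by
  constructor
  · rintro h ⟨h1, h2⟩
    exact layeredWindows_false_without_groundState (h h1 h2)
  · intro h h1 h2
    exact absurd ⟨h1, h2⟩ h

/-! ## §4 Logical position of the crux (why an unconditional `¬ HullBridge` is out of reach)

`¬ HullBridge ↔ CoerciveTwoShellGap ∧ NearFieldConvexity ∧ ¬ LayeredWindows`: a refutation must PROVE both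
XL antecedent cruxes and REFUTE the positional crystallization content `LayeredWindows` (expected true for
Lennard-Jones: `a* ≈ 0.9712 ∈ [47/50, 1]`, `h/a ≈ 0.8165 ∈ [39/50, 17/20]`, any Barlow stacking admitted).
Conversely each of the following alone proves the crux. -/

theorem not_hullBridge_iff :
    ¬ HullBridge ↔ (CoerciveTwoShellGap ∧ NearFieldConvexity ∧ ¬ LayeredWindows) := by
  rw [hullBridge_iff]; tauto

/-- The crux is weaker than its conclusion … -/
theorem hullBridge_of_layeredWindows (h : LayeredWindows) : HullBridge := fun _ _ => h

/-- … and vacuous if either antecedent crux falls. -/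
theorem hullBridge_of_not_coerciveTwoShellGap (h : ¬ CoerciveTwoShellGap) : HullBridge :=
  fun h1 _ => absurd h1 h

theorem hullBridge_of_not_nearFieldConvexity (h : ¬ NearFieldConvexity) : HullBridge :=
  fun _ h2 => absurd h2 h

/-! ## §5 Line `Sketch` (PICKED): the only remaining atom is `PrestressSplitKorn.ExactLayeredRigidity`

Chain read from the tree (all sorry-free, landed): `HullBridge` ⟸ `LayeredGluing` by
`HullBridgeExact.stub_badFraction / stub_nonLayeredFraction / stub_cleanCentres / stub_windowsOfGluing`
(+ `hb_exists_global_spacing`), and `LayeredGluing` ⟸ `ExactLayeredRigidity`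
(`PrestressSplitKorn.layeredGluing_of_exactRigidity`, file `…LayeredGluing02`).  `LayeredGluing` is a
statement about ALL `δ`-separated configurations (no energy), so the line is refutable by pure geometry iff
`ExactLayeredRigidity` (or its windowed form) fails.

ATTACK (paper, recorded in NOTES.md; no counterexample found — the atom is very likely TRUE):
* ROW LEMMA (`registry_lemma` below is its arithmetic core).  If a plane tilted against the layers of a box
  template carries an equilateral triangular patch of the template with `≥ 2` points on each of `≥ 3`
  consecutive rows, then consecutive rows come from consecutive layers with lateral shift
  `(σ + 3m)·a√3/6`, `σ = ±1` the Hägg letter, and row gap `a√3/2`; `registry_lemma` forces `m = 0` and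
  `h² = 2a²/3`: the crossed layers are IDEALLY spaced with CONSTANT letter (`cos θ = σ/3`, `θ = 70.53°`),
  i.e. locally ideal fcc.  Small tilts are impossible outright (patch points would sit between layers).
* Hence a 2-ball (or the lens `⊇ B(mid, 1.48)` of two in-layer neighbours) that is layered w.r.t. two
  non-parallel normals is ideal fcc on its core; an hcp-like layer (letter change) or a non-ideally spaced
  layer pair makes the normal UNIQUE, and the lens pins the neighbour's template to the same three planes:
  every such feature propagates to a COMPLETE plane sandwiched by complete planes.
* Two complete features with non-parallel normals meet; a point of one within `0.6` of the other has a
  2-ball containing a tilted complete-plane patch ⇒ ideal fcc on its layers `-1, 0, 1` ⇒ contradiction.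
  So all features are parallel ⇒ `Y` is one template (or featureless ⇒ the fcc lattice, also a template).
  Margins: the lens core radius `1.48` exceeds the `≈ 1.3` the row lemma needs at `a = 1`, `h = 17/20`.
This agrees with the ideator's grid numerics (`NumericsMergeFits.md`: 8/5184 bi-layered balls, all ideal fcc).

QUANTIFIER ORDER in `LayeredGluing` (paper remark, not formalised — `Good` bookkeeping for a strained ball is
~10³ lines): with `η` chosen BEFORE `ε` the gluing statement is false by a box-edge dilation — the fcc ball of
spacing `1 + η/4` is `η`-layered (template `a = 1`) and two-shell good everywhere, yet admits no
`(R, η/100)`-window for any `R ≥ 2`: an equilateral particle triangle of side `1 + η/4` has no `η/50`-match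
among template triangles (two sides `≈ 1 + η/4 > a` must be inter-layer bonds; the third side is then in-plane
`= a ≤ 1` or spans two layers `≥ 1.46`).  So `η(ε) ≲ ε` is forced already at `R = 2`, before the
`η ≲ ε a²/R²` accumulation bound; the tree's order (`η` after `R, ε`) is the right one.

UPDATE 2026-08-16T12:1xZ: the lead landed `HullBridgeExact.hullBridge_of_exactLayeredRigidity :
ExactLayeredRigidity → HullBridge` (p98351, `Theorems/PhononSlackCertificatesHullBridgeOfGluing.lean`).  By
contraposition ANY kill of this crux is now a counterexample to the pure-geometry atom `ExactLayeredRigidity`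
(and conversely the sibling's in-flight proof of the atom closes the crux by a one-liner).  The disprover's
attack on the atom (above) found none; next-cycle effort, if re-armed, goes ONLY there (lens point counts at
the sparse box corner `a = 1`, `h = 17/20`; windowed form).

LANDED from this file: `Theorems/HullBridge/Negative/WindowsNeedMinimality.lean` = §0–§3 + `registry_lemma`
(p99525, ACCEPTED 2026-08-16T11:48Z).
-/

/-- **Registry lemma** (arithmetic core of "bi-layered ⇒ ideal fcc"): a lateral registry shift
`(σ + 3m)·a·√3/6` (`σ = ±1`) and a box height `h ∈ [39a/50, 17a/20]` realise the triangular row gap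
`a√3/2` only for `m = 0` and the ideal height `h² = 2a²/3`. [folklore] -/
theorem registry_lemma {a h σ : ℝ} {m : ℤ} (ha : 47 / 50 ≤ a)
    (hh : 39 / 50 * a ≤ h) (hh1 : h ≤ 17 / 20 * a) (hσ : σ = 1 ∨ σ = -1)
    (hgap : ((σ + 3 * m) * a * √3 / 6) ^ 2 + h ^ 2 = (a * √3 / 2) ^ 2) :
    m = 0 ∧ h ^ 2 = 2 / 3 * a ^ 2 := by
  have h3 : (√3 : ℝ) ^ 2 = 3 := Real.sq_sqrt (by norm_num)
  have ha0 : 0 < a := by linarith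
  -- normalise: (σ + 3m)² a² / 12 + h² = 3 a² / 4
  have key : (σ + 3 * m) ^ 2 * a ^ 2 / 12 + h ^ 2 = 3 * a ^ 2 / 4 := by
    have e1 : ((σ + 3 * m) * a * √3 / 6) ^ 2 = (σ + 3 * m) ^ 2 * a ^ 2 * (√3) ^ 2 / 36 := by ring
    have e2 : (a * √3 / 2) ^ 2 = a ^ 2 * (√3) ^ 2 / 4 := by ring
    rw [e1, e2, h3] at hgap
    linarith
  -- (σ+3m)² ∈ (0.3, 1.7) hence = 1
  have hq_lo : (σ + 3 * m) ^ 2 * a ^ 2 < 2 * a ^ 2 := by nlinarith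
  have hq_hi : 0 < (σ + 3 * m) ^ 2 * a ^ 2 := by nlinarith
  have ha2 : 0 < a ^ 2 := by positivity
  have hq1 : (σ + 3 * m) ^ 2 < 2 := by
    by_contra hc; push Not at hc; nlinarith
  have hm : m = 0 := by
    rcases hσ with rfl | rfl
    · have : ((1 + 3 * m : ℤ) : ℝ) ^ 2 < 2 := by push_cast; exact hq1
      have hi : (1 + 3 * m) ^ 2 < 2 := by exact_mod_cast this
      nlinarith
    · have : ((-1 + 3 * m : ℤ) : ℝ) ^ 2 < 2 := by push_cast; exact hq1
      have hi : (-1 + 3 * m) ^ 2 < 2 := by exact_mod_cast this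
      nlinarith
  subst hm
  have hs : (σ + 3 * ((0 : ℤ) : ℝ)) ^ 2 = 1 := by
    rcases hσ with rfl | rfl <;> norm_num
  rw [hs] at key
  exact ⟨rfl, by linarith⟩

/-- Sanity: the hypothesis of the atom is satisfied by every box template itself (identity frame, `t = 0`),
so `ExactLayeredRigidity` is not vacuous and its conclusion format is the right one. -/
theorem exactNear_template {a : ℝ} {s : ℤ → ℤ} {z : ℤ → ℝ} (h : InBox a z) (hs : IsHaggSeq s)
    (l₀ : ℤ × ℤ × ℤ) :
    ExactNear (Set.range (layeredPos a s z)) (layeredPos a s z l₀) := by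
  refine ⟨LinearIsometry.id, 0, a, s, z, h, hs, ?_, ?_⟩
  · rintro y ⟨l, rfl⟩ -
    exact ⟨l, by simp⟩
  · intro l _
    exact ⟨l, by simp⟩

end Summit.AtomisticToContinuum.Crystallization.Cruxes.HullBridge.Disproof

end
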